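import Summits.RiemannHypothesis.RiemannHypothesis.Theses.IntegerScrew
import Literature.NumberTheory.LFunctions.ZetaScrewThm17Proofs
import HarnessLib

/-!
# Line `robust-landau` for crux `IntegerScrew.DiscreteLandau` (stmt-RiemannHypothesis-15758)

`DiscreteLandau : (∀ m ≥ 1, Ψ(log m) ≥ 0) → RiemannHypothesis`, `Ψ = zetaScrew` (Suzuki2023 (1.1)).

STRENGTHEN lens at crux level (crux-strategist b1, 2026-08-17). The crux is the composition of
exactly TWO lemmas, each stated so that it is a *minimal diff* against code already in the tree:

* `stub_nodeSlack` — NODE SLACK (real-variable, unconditional): integer sampling of `Ψ` loses at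
  most a constant: `∃ K, ∀ t ≥ 0, Ψ(log ⌊e^t⌋) - K ≤ Ψ(t)`. On the floor cell `log m ≤ t < log(m+1)`
  the archimedean part `4(e^{t/2}+e^{-t/2}-2) = 8(cosh(t/2)-1)` is increasing (`Real.cosh_le_cosh`),
  the Hurwitz–Lerch part `-¼ e^{-t/2} Φ(e^{-2t},2,¼)` is increasing (product of two non-negative
  antitone factors, `hurwitzLerchQuarter` termwise), the linear part has slope `-c₀/2`,
  `c₀ = γ + π/2 + 3 log 2 + log π < 5.4`, and the prime sum is `(t - log m)`-Lipschitz on the cell with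
  constant `S(m+1) = Σ_{n ≤ m+1} Λ(n)/√n ≤ 2(m+1)` (`zetaScrewPrimeSum_eq_sum_max`, `Λ(n) ≤ log n ≤ 2√n`);
  with `t - log m ≤ log(1 + 1/m) ≤ 1/m` the drop is `≤ (2(m+1) + 2.7)/m ≤ 7`. (Verbatim the prepared
  split child `ScrewNodeInterpolation` of SPLIT-PLAN.md, so the stub survives a later `--split`.)
* `stub_robustLandau` — ROBUST LANDAU DETECTION (RH-free): if `Ψ ≥ -K` on `[0, ∞)` then
  `ξ(1/2 + w₀) ≠ 0` for every `Re w₀ > 0`. This is the tree's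
  `ZetaScrewLandau.riemannXi_ne_zero_of_zetaScrew_nonneg` (ZetaScrewThm17Proofs.lean, lines 208–350)
  run on `g(x) = Ψ(log x) + K ≥ 0` instead of `Ψ(log x)`: its transform is
  `R(s) + K/s = s⁻²(ξ'/ξ)(1/2+s) + K/s` on `Re s > 1` (linearity of `Landau.mellinIoi` +
  `∫_1^∞ x^{-(s+1)} dx = 1/s`, `integral_Ioi_cpow_of_lt`), still holomorphic on `{Re s > 1} ∪ W₀`
  (the slack's only pole is `s = 0 ∉ W₀ ⊂ {Re s > ε/2}`), so
  `Landau.integrableOn_of_differentiableOn_union_convex` pushes absolute convergence of `g` — hence of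
  `Ψ∘log` after subtracting the integrable `K x^{-(σ+1)}` — below every `ε > 0`; the identity-theorem
  and order-of-vanishing half is then verbatim.

`DiscreteLandau_of` composes the two stub STATEMENTS into the crux BY NAME, sorry-free: for `t ≥ 0`
the node `⌊e^t⌋ ≥ 1`, so the crux hypothesis + `stub_nodeSlack` give `Ψ ≥ -K` on `[0,∞)`;
`stub_robustLandau` excludes zeros of `ξ(1/2+·)` in `Re > 0`, i.e. zeros of `ζ` with
`1/2 < Re s < 1` (`riemannXi_eq_zero_iff_holds`), which is RH (`quasiRiemannHypothesis_one_half_iff_holds`).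

Relation to line `split-landau` (r1, 7 stubs): same lever (slack-tolerant Landau), coarser CUT —
`stub_nodeSlack` = its piece P1 verbatim; `stub_robustLandau` = its P2 ∧ P3 fused in the shape of the
tree lemma (no intermediate `∀ σ > 0` abscissa statement, no `∃ F` continuation object), so that a
`--supports` file may land the monolithic ~60-line adaptation of the tree proof verbatim.
-/

namespace Summit.RiemannHypothesis.RiemannHypothesis.Cruxes.DiscreteLandau.RobustLandau

open Literature.NumberTheory.LFunctions

/-! ## The two stub statements as named propositions (the skeleton audit matches BY NAME) -/

namespace Sig

/-- Stub 1 statement — node slack (= prepared split child `ScrewNodeInterpolation`, verbatim). -/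
def stub_nodeSlack : Prop :=
  ∃ K : ℝ, ∀ t : ℝ, 0 ≤ t →
    Literature.NumberTheory.LFunctions.zetaScrew (Real.log (⌊Real.exp t⌋₊ : ℕ)) - K ≤
      Literature.NumberTheory.LFunctions.zetaScrew t

/-- Stub 2 statement — robust Landau detection. -/
def stub_robustLandau : Prop :=
  ∀ K : ℝ, (∀ t : ℝ, 0 ≤ t → -K ≤ Literature.NumberTheory.LFunctions.zetaScrew t) →
    ∀ w₀ : ℂ, 0 < w₀.re → Literature.NumberTheory.LFunctions.riemannXi (1 / 2 + w₀) ≠ 0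

end Sig

/-- STUB 1 (node slack; S–M, real-variable). `∃ K, ∀ t ≥ 0, Ψ(log ⌊e^t⌋) - K ≤ Ψ(t)`:
on a floor cell the explicit parts of (1.1) are monotone and the prime sum is Lipschitz with
constant `S(m+1) ≤ 2(m+1)`, while the cell has length `≤ 1/m`. -/
theorem stub_nodeSlack : ∃ K : ℝ, ∀ t : ℝ, 0 ≤ t →
    Literature.NumberTheory.LFunctions.zetaScrew (Real.log (⌊Real.exp t⌋₊ : ℕ)) - K ≤
      Literature.NumberTheory.LFunctions.zetaScrew t := by
  sorry

/-- STUB 2 (robust Landau detection; M, the load-bearing stub). If `Ψ(t) ≥ -K` for all `t ≥ 0`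
then `ξ(1/2 + w₀) ≠ 0` whenever `Re w₀ > 0`: the tree's
`ZetaScrewLandau.riemannXi_ne_zero_of_zetaScrew_nonneg` with `g = Ψ∘log + K`, transform
`s⁻²(ξ'/ξ)(1/2+s) + K/s` (pole of the slack at `0`, left of every Landau rectangle). -/
theorem stub_robustLandau : ∀ K : ℝ,
    (∀ t : ℝ, 0 ≤ t → -K ≤ Literature.NumberTheory.LFunctions.zetaScrew t) →
    ∀ w₀ : ℂ, 0 < w₀.re → Literature.NumberTheory.LFunctions.riemannXi (1 / 2 + w₀) ≠ 0 := by
  sorry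

/-! ## Composition to the crux BY NAME -/

/-- The two stub STATEMENTS imply the crux `IntegerScrew.DiscreteLandau` (sorry-free). -/
theorem DiscreteLandau_of (h1 : Sig.stub_nodeSlack) (h2 : Sig.stub_robustLandau) :
    Summit.RiemannHypothesis.RiemannHypothesis.Theses.IntegerScrew.DiscreteLandau := by
  intro hm
  obtain ⟨K, hK⟩ := h1
  -- the crux hypothesis at the nodes + node slack: `Ψ ≥ -K` on `[0, ∞)`
  have hbdd : ∀ t : ℝ, 0 ≤ t → -K ≤ zetaScrew t := by
    intro t ht
    have hfloor : 1 ≤ ⌊Real.exp t⌋₊ := (Nat.one_le_floor_iff _).2 (Real.one_le_exp ht)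
    have hnode := hm _ hfloor
    have hint := hK t ht
    linarith
  -- no zeros of `ξ(1/2 + ·)` in `Re > 0` ⇒ no zeros of `ζ` in `1/2 < Re s < 1` ⇒ RH
  refine quasiRiemannHypothesis_one_half_iff_holds.1 fun s hs h1' h2' ↦ ?_
  have hξ : riemannXi s = 0 := (riemannXi_eq_zero_iff_holds s).2 ⟨hs, by linarith, h2'⟩
  have hw : 0 < (s - 1 / 2).re := by simp; linarith
  refine h2 K hbdd (s - 1 / 2) hw ?_
  rw [show (1 / 2 : ℂ) + (s - 1 / 2) = s by ring]
  exact hξ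

/-- The crux modulo exactly the two `stub_*` sorries (audit: sorries only inside `stub_*`). -/
theorem discreteLandau :
    Summit.RiemannHypothesis.RiemannHypothesis.Theses.IntegerScrew.DiscreteLandau :=
  DiscreteLandau_of stub_nodeSlack stub_robustLandau

end Summit.RiemannHypothesis.RiemannHypothesis.Cruxes.DiscreteLandau.RobustLandau
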